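import Summits.AtomisticToContinuum.FouriersLaw.Theses.OddSectorIrreversibility
import Summits.AtomisticToContinuum.FouriersLaw.Theses.JunctionLocality

/-!
# `BoundedResponseConverges` / Negative: kill criteria for the two-scale and ladder lines

Negative knowledge for crux `stmt-AtomisticToContinuum-9141`
(`OddSectorIrreversibility.BoundedResponseConverges`), crux disprover, cycle 2 (2026-08-16);
companion of `TwoScaleLoadBearing.lean` (stubs (U) `UpperIncrement`, (S23) `SelfSimilarGluing` of card
two-scale-gluing-log-rigidity; ladder stub `D_N ≤ D_{N+1}` eventually of cards
ohmic-floor-monotone-ladder ≈ length-monotone-kirchhoff-mean; `R_N := (N-1)/D_N`).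

* `boundedResponseConverges_fourierShape_not_upperIncrement_nor_ladder` — the crux's / Fourier's
  CONCLUSION (`D_N → k > 0`) implies neither (U) nor the ladder: `D_N = 1 + (-1)^N/√N → 1` has
  unbounded resistance increments (`≥ 1 + N/√(N+1)`) and is nowhere eventually monotone. Both lines
  prove MORE than the crux and are falsifiable by even–odd finite-size effects of amplitude `≫ 1/N`
  that leave Fourier's law intact.
* `boundedResponseConverges_floor_of_upperIncrement` /
  `boundedResponseConverges_conductanceLowerBound_of_upperIncrement` — (U) is not "positivity for
  free": its shape forces an `N`-uniform floor `D_N ≥ c > 0`, so (U) along the conjunct's responses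
  implies `JunctionLocality.ConductanceLowerBound` (stmt-11749); an insulator point kills the line.
* `boundedResponseConverges_ladder_matrix_iff` — granted the ladder stub and the crux's boundedness,
  the crux's matrix holds iff `D` is positive somewhere beyond the threshold: the only compatible kill
  is an eventually currentless chain.
Pure real analysis (plus one unfolding); nothing here closes an item.
-/

noncomputable section

namespace Summit.AtomisticToContinuum.FouriersLaw.Theorems

open MeasureTheory Filter Topology
open Literature.MathematicalPhysics.KineticTheory.HeatConduction

/-- **(U) forces a conductance floor** (shape level): if eventually `0 < D_N` and
`N/D_{N+1} ≤ (N-1)/D_N + C` (i.e. `R_{N+1} ≤ R_N + C`, `R_N = (N-1)/D_N`), then `D_N ≥ c > 0`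
eventually (`R_N` grows at most linearly). [folklore] -/
theorem boundedResponseConverges_floor_of_upperIncrement {D : ℕ → ℝ}
    (h : ∃ C : ℝ, ∃ N₀ : ℕ, ∀ N : ℕ, N₀ ≤ N →
      0 < D N ∧ (N : ℝ) / D (N + 1) ≤ ((N : ℝ) - 1) / D N + C) :
    ∃ c : ℝ, 0 < c ∧ ∃ N₁ : ℕ, ∀ N : ℕ, N₁ ≤ N → c ≤ D N := by
  obtain ⟨C, N₀, hU⟩ := h
  set R : ℕ → ℝ := fun N => ((N : ℝ) - 1) / D N with hRdef
  have hU0 : ∀ N, N₀ ≤ N → 0 < D N ∧ R (N + 1) ≤ R N + C := fun N hN => by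
    obtain ⟨h1, h2⟩ := hU N hN
    refine ⟨h1, ?_⟩
    simp only [hRdef]; push_cast
    rw [show (N : ℝ) + 1 - 1 = N by ring]; exact h2
  set N₁ := max N₀ 2 with hN₁
  have hU' : ∀ N, N₁ ≤ N → 0 < D N ∧ R (N + 1) ≤ R N + C := fun N hN =>
    hU0 N (le_trans (le_max_left _ _) hN)
  have hN₁2 : 2 ≤ N₁ := le_max_right _ _
  set C' := max C 1 with hC'
  have hC'pos : 0 < C' := lt_of_lt_of_le one_pos (le_max_right _ _)
  set R₀ := R N₁ with hR₀
  have hR₀pos : 0 < R₀ := by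
    have hD := (hU' N₁ le_rfl).1
    have : (2 : ℝ) ≤ N₁ := by exact_mod_cast hN₁2
    simp only [hR₀, hRdef]
    exact div_pos (by linarith) hD
  have hlin : ∀ m : ℕ, R (N₁ + m) ≤ R₀ + C' * m := by
    intro m
    induction m with
    | zero => simp [hR₀]
    | succ m ih =>
      have hstep := (hU' (N₁ + m) (Nat.le_add_right _ _)).2
      have hCC : C ≤ C' := le_max_left _ _
      rw [show N₁ + (m + 1) = N₁ + m + 1 by ring]
      push_cast
      nlinarith
  refine ⟨1 / (2 * (R₀ + C')), by positivity, N₁, fun N hN => ?_⟩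
  obtain ⟨m, rfl⟩ := Nat.exists_eq_add_of_le hN
  have hD := (hU' (N₁ + m) hN).1
  have hm0 : (0 : ℝ) ≤ m := by positivity
  have hkey : ((N₁ + m : ℕ) : ℝ) - 1 ≤ (R₀ + C' * m) * D (N₁ + m) := by
    have := hlin m
    simp only [hRdef] at this
    rw [div_le_iff₀ hD] at this
    exact this
  have hX : 0 < R₀ + C' * m := by positivity
  have hn1 : (m : ℝ) + 1 ≤ ((N₁ + m : ℕ) : ℝ) - 1 := by
    push_cast
    have : (2 : ℝ) ≤ N₁ := by exact_mod_cast hN₁2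
    linarith
  have hA : R₀ + C' * m ≤ 2 * (R₀ + C') * (((N₁ + m : ℕ) : ℝ) - 1) := by
    have hRC : 0 ≤ R₀ + C' := by positivity
    nlinarith [mul_le_mul_of_nonneg_left hn1 hRC, hR₀pos.le, hC'pos.le, hm0]
  have hC2 : 0 ≤ 2 * (R₀ + C') := by positivity
  have h3 : R₀ + C' * m ≤ 2 * (R₀ + C') * ((R₀ + C' * m) * D (N₁ + m)) :=
    le_trans hA (mul_le_mul_of_nonneg_left hkey hC2)
  have h4 : (R₀ + C' * m) * 1 ≤ (R₀ + C' * m) * (D (N₁ + m) * (2 * (R₀ + C'))) := by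
    have : 2 * (R₀ + C') * ((R₀ + C' * m) * D (N₁ + m)) =
        (R₀ + C' * m) * (D (N₁ + m) * (2 * (R₀ + C'))) := by ring
    linarith [h3, this]
  rw [div_le_iff₀ (by positivity)]
  exact le_of_mul_le_mul_left h4 hX

/-- **Fourier's conclusion does not imply (U), nor the ladder**: a response-shaped sequence
(`D 0 = D 1 = 0`, `0 < D_N` for `N ≥ 2`, bounded) converging to the POSITIVE limit `1` — so the crux's
(and `FouriersLawFor`'s) conclusion holds for it — whose parity oscillation `D_N = 1 + (-1)^N/√N`
decays so slowly that the resistance increments `R_{N+1} - R_N ≥ 1 + N/√(N+1)` are unbounded (¬(U))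
and `D` is not eventually non-decreasing (¬ ladder). The two-scale and ladder lines therefore prove
MORE than the crux: their stubs are falsifiable by even–odd finite-size effects of amplitude `≫ 1/N`
that leave Fourier's law intact. [folklore] -/
theorem boundedResponseConverges_fourierShape_not_upperIncrement_nor_ladder :
    ∃ D : ℕ → ℝ, D 0 = 0 ∧ D 1 = 0 ∧ (∀ N : ℕ, 2 ≤ N → 0 < D N ∧ D N ≤ 2) ∧
      BddAbove (Set.range fun N => |D N|) ∧ Tendsto D atTop (𝓝 1) ∧
      (¬ ∃ C : ℝ, ∃ N₀ : ℕ, ∀ N : ℕ, N₀ ≤ N →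
          0 < D N ∧ (N : ℝ) / D (N + 1) ≤ ((N : ℝ) - 1) / D N + C) ∧
      ¬ ∃ N₀ : ℕ, ∀ N : ℕ, N₀ ≤ N → D N ≤ D (N + 1) := by
  set a : ℕ → ℝ := fun N => 1 / Real.sqrt N with ha
  set D : ℕ → ℝ := fun N => if N < 2 then 0 else 1 + (-1) ^ N * a N with hD
  have hval : ∀ N : ℕ, 2 ≤ N → D N = 1 + (-1) ^ N * a N := fun N hN => by
    have h : ¬ N < 2 := by omega
    simp only [hD, h, if_false]
  -- `0 < a N ≤ 1/√2 < 1` for `N ≥ 2`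
  have ha_pos : ∀ N : ℕ, 1 ≤ N → 0 < a N := fun N hN => by
    simp only [ha]; exact one_div_pos.2 (Real.sqrt_pos.2 (by exact_mod_cast hN))
  have ha_lt : ∀ N : ℕ, 2 ≤ N → a N < 1 := fun N hN => by
    simp only [ha]
    rw [div_lt_one (Real.sqrt_pos.2 (by positivity))]
    rw [show (1 : ℝ) = Real.sqrt 1 from Real.sqrt_one.symm]
    exact Real.sqrt_lt_sqrt (by norm_num) (by exact_mod_cast hN)
  have hbounds : ∀ N : ℕ, 2 ≤ N → 0 < D N ∧ D N ≤ 2 := fun N hN => by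
    rw [hval N hN]
    have h0 := ha_pos N (by omega); have h1 := ha_lt N hN
    rcases neg_one_pow_eq_or ℝ N with h | h <;> rw [h] <;> constructor <;> linarith
  -- `a N → 0`
  have ha_lim : Tendsto a atTop (𝓝 0) := by
    have h1 : Tendsto (fun N : ℕ => Real.sqrt (N : ℝ)) atTop atTop :=
      Real.tendsto_sqrt_atTop.comp tendsto_natCast_atTop_atTop
    have h2 := tendsto_inv_atTop_zero.comp h1
    refine h2.congr fun N => ?_
    simp only [ha, Function.comp_apply, one_div]
  have hlim : Tendsto D atTop (𝓝 1) := by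
    have h2 : Tendsto (fun N : ℕ => 1 + (-1 : ℝ) ^ N * a N) atTop (𝓝 1) := by
      have hb : Tendsto (fun N : ℕ => (-1 : ℝ) ^ N * a N) atTop (𝓝 0) := by
        refine squeeze_zero_norm (fun N => ?_) ha_lim
        rw [norm_mul, norm_pow, norm_neg, norm_one, one_pow, one_mul, Real.norm_eq_abs,
          abs_of_nonneg]
        simp only [ha]; positivity
      simpa using tendsto_const_nhds.add hb
    refine h2.congr' ?_
    filter_upwards [eventually_ge_atTop 2] with N hN
    rw [hval N hN]
  refine ⟨D, by simp [hD], by simp [hD], hbounds, ⟨2, ?_⟩, hlim, ?_, ?_⟩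
  · rintro _ ⟨N, rfl⟩
    dsimp only
    by_cases hN : 2 ≤ N
    · obtain ⟨hl, hu⟩ := hbounds N hN
      rw [abs_of_nonneg hl.le]; exact hu
    · have hlt : N < 2 := by omega
      have h0 : D N = 0 := by simp only [hD]; exact if_pos hlt
      rw [h0]; norm_num
  · -- ¬ (U): at even `N`, `R_{N+1} - R_N ≥ 1 + N a (N+1) ≥ 1 + N/√(N+1)`, unbounded
    rintro ⟨C, N₀, hU⟩
    -- WLOG `C ≥ 0`
    set C' := max C 0 with hC'
    have hC'0 : 0 ≤ C' := le_max_right _ _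
    -- a large even index
    set N : ℕ := 2 * (N₀ + ⌈C' ^ 2⌉₊ + 1) with hNdef
    have hNN₀ : N₀ ≤ N := by omega
    have hN2 : 2 ≤ N := by omega
    have hNeven : Even N := ⟨N₀ + ⌈C' ^ 2⌉₊ + 1, by omega⟩
    have hNC : 2 * C' ^ 2 ≤ N := by
      have h1 : C' ^ 2 ≤ ⌈C' ^ 2⌉₊ := Nat.le_ceil _
      have h2 : ((2 * (N₀ + ⌈C' ^ 2⌉₊ + 1) : ℕ) : ℝ) = 2 * ((N₀ : ℝ) + ⌈C' ^ 2⌉₊ + 1) := by push_cast; ring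
      rw [hNdef, h2]
      have : (0 : ℝ) ≤ N₀ := by positivity
      nlinarith
    obtain ⟨hDN, hinc⟩ := hU N hNN₀
    obtain ⟨hDN1, -⟩ := hU (N + 1) (by omega)
    have hvalN : D N = 1 + a N := by
      rw [hval N hN2, Even.neg_one_pow hNeven, one_mul]
    have hvalN1 : D (N + 1) = 1 - a (N + 1) := by
      rw [hval (N + 1) (by omega), Odd.neg_one_pow (Even.add_one hNeven)]; ring
    have haN := ha_pos N (by omega)
    have haN1 := ha_pos (N + 1) (by omega)
    have haN1' := ha_lt (N + 1) (by omega)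
    have hNr : (2 : ℝ) ≤ N := by exact_mod_cast hN2
    -- lower bound on the increment
    have h1 : (N : ℝ) * (1 + a (N + 1)) ≤ (N : ℝ) / D (N + 1) := by
      rw [hvalN1, le_div_iff₀ (by linarith)]
      nlinarith [mul_pos haN1 haN1]
    have h2 : ((N : ℝ) - 1) / D N ≤ (N : ℝ) - 1 := by
      rw [hvalN, div_le_iff₀ (by linarith)]
      nlinarith
    have hinc' : (N : ℝ) / D (N + 1) ≤ ((N : ℝ) - 1) / D N + C' := by
      linarith [le_max_left C 0, hinc]
    -- so `1 + N a(N+1) ≤ C'`, but `N a (N+1) = N/√(N+1) ≥ C'`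
    have h3 : (N : ℝ) * a (N + 1) ≥ C' := by
      simp only [ha]
      push_cast
      rw [mul_one_div, ge_iff_le, le_div_iff₀ (Real.sqrt_pos.2 (by positivity))]
      -- `C' √(N+1) ≤ N` from `C'^2 (N+1) ≤ N^2`
      have hs := Real.sq_sqrt (show (0 : ℝ) ≤ (N : ℝ) + 1 by positivity)
      have hsn := Real.sqrt_nonneg ((N : ℝ) + 1)
      have hsq : C' ^ 2 * ((N : ℝ) + 1) ≤ (N : ℝ) ^ 2 := by nlinarith
      nlinarith [mul_nonneg hC'0 hsn, sq_nonneg (C' * Real.sqrt ((N : ℝ) + 1) - N)]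
    linarith
  · -- ¬ ladder: `D N > 1 > D (N+1)` at every even `N ≥ max N₀ 2`
    rintro ⟨N₀, hmono⟩
    set N : ℕ := 2 * (N₀ + 1) with hNdef
    have hNeven : Even N := ⟨N₀ + 1, by omega⟩
    have h := hmono N (by omega)
    rw [hval N (by omega), hval (N + 1) (by omega), Even.neg_one_pow hNeven,
      Odd.neg_one_pow (Even.add_one hNeven)] at h
    have := ha_pos N (by omega); have := ha_pos (N + 1) (by omega)
    linarith

/-- **Kill criterion (two-scale line)**: stub (U) along the conjunct's responses (the matrix of card
two-scale-gluing-log-rigidity's `UpperIncrement`, prefix written out) implies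
`JunctionLocality.ConductanceLowerBound` (stmt-11749). [folklore] -/
theorem boundedResponseConverges_conductanceLowerBound_of_upperIncrement
    (hU : ∀ ω₂ lam β γ : ℝ, 0 < ω₂ → 0 < lam → 0 < β → 0 < γ →
      (∀ (N : ℕ) (T_L T_R : ℝ), 0 < T_L → 0 < T_R → ∀ μ ν : Measure (PhaseSpace N),
        (pinnedChain ω₂ lam β γ).IsSteadyState N T_L T_R μ →
          (pinnedChain ω₂ lam β γ).IsSteadyState N T_L T_R ν → μ = ν) →
      ∀ μ : (N : ℕ) → ℝ → ℝ → Measure (PhaseSpace N),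
        (∀ (N : ℕ) (T_L T_R : ℝ), 0 < T_L → 0 < T_R →
          (pinnedChain ω₂ lam β γ).IsSteadyState N T_L T_R (μ N T_L T_R)) →
        ∀ T : ℝ, 0 < T → ∀ D : ℕ → ℝ,
          (∀ N : ℕ, Tendsto (fun δ : ℝ =>
              (pinnedChain ω₂ lam β γ).totalCurrent (μ N (T + δ / 2) (T - δ / 2)) / δ)
            (𝓝[≠] 0) (𝓝 (D N))) →
          ∃ C : ℝ, ∃ N₀ : ℕ, ∀ N : ℕ, N₀ ≤ N →
            0 < D N ∧ (N : ℝ) / D (N + 1) ≤ ((N : ℝ) - 1) / D N + C) :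
    Theses.JunctionLocality.ConductanceLowerBound := by
  intro ω₂ lam β γ hω hl hβ hγ hu μ hμ T hT D hD
  exact boundedResponseConverges_floor_of_upperIncrement (hU ω₂ lam β γ hω hl hβ hγ hu μ hμ T hT D hD)

/-- **Kill criterion (ladder line)**: granted an eventually non-decreasing `D` with `|D|` bounded,
the crux's matrix holds iff `D` is positive somewhere beyond the threshold. [folklore] -/
theorem boundedResponseConverges_ladder_matrix_iff {D : ℕ → ℝ} {N₀ : ℕ}
    (hmono : ∀ N : ℕ, N₀ ≤ N → D N ≤ D (N + 1)) (hB : BddAbove (Set.range fun N => |D N|)) :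
    (∃ k : ℝ, 0 < k ∧ Tendsto D atTop (𝓝 k)) ↔ ∃ N : ℕ, N₀ ≤ N ∧ 0 < D N := by
  constructor
  · rintro ⟨k, hk, hlim⟩
    have hev : ∀ᶠ N in atTop, 0 < D N := hlim.eventually (eventually_gt_nhds hk)
    obtain ⟨N, hN⟩ := (hev.and (eventually_ge_atTop N₀)).exists
    exact ⟨N, hN.2, hN.1⟩
  · rintro ⟨N₂, hN₂, hpos⟩
    obtain ⟨B, hBB⟩ := hB
    have hfm : Monotone (fun n : ℕ => D (N₀ + n)) := by
      refine monotone_nat_of_le_succ fun n => ?_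
      have h := hmono (N₀ + n) (Nat.le_add_right _ _)
      simpa [add_assoc] using h
    have hfb : BddAbove (Set.range fun n : ℕ => D (N₀ + n)) := by
      refine ⟨B, ?_⟩
      rintro _ ⟨n, rfl⟩
      exact le_trans (le_abs_self _) (hBB ⟨N₀ + n, rfl⟩)
    have hlim := tendsto_atTop_ciSup hfm hfb
    refine ⟨⨆ n : ℕ, D (N₀ + n), ?_, ?_⟩
    · have h1 : D (N₀ + (N₂ - N₀)) ≤ ⨆ n : ℕ, D (N₀ + n) := le_ciSup hfb (N₂ - N₀)
      rw [Nat.add_sub_cancel' hN₂] at h1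
      exact lt_of_lt_of_le hpos h1
    · have h2 : Tendsto (fun n => D (n + N₀)) atTop (𝓝 (⨆ n : ℕ, D (N₀ + n))) :=
        hlim.congr fun n => by rw [Nat.add_comm N₀ n]
      exact (tendsto_add_atTop_iff_nat N₀).mp h2

end Summit.AtomisticToContinuum.FouriersLaw.Theorems

end
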